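import Summits.BirchSwinnertonDyer.BirchSwinnertonDyer.Theorems.GenusKolyvaginAtTwoGenusDeepSupplyAtTwoNegDiscNarrowDepthZeroInstance
import Summits.BirchSwinnertonDyer.BirchSwinnertonDyer.Theorems.GenusKolyvaginAtTwoGenusPrimitiveSupplyAtTwoPosDiscShallowStubCSplit
import HarnessLib

/-!
# Route `GenusKolyvaginAtTwo`, crux 25504 `GenusPrimitiveSupplyAtTwoPosDiscShallow` (Δ>0), registered stub C⁺‴ on the `#Sel₂(E) = 1` cell:
# K₁⁺ ⟸ ONE REDUCTION BIT R₁⁺ — the Δ>0 supply crux from FIVE ROUTE ITEMS + R₁⁺ + K₄⁺ (twin of `…NegDiscNarrowDepthZeroK1OfReductionBit`)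

Seat `bsd-line-gk2-p5` g33 (cell `bsd-f1-sign2`, WIDTH-5 attach), `--supports stmt-BirchSwinnertonDyer-25504 --as helper`.
THEOREMS ONLY (no definition, no named fact, no `sorry`).  **BSD is NOT proved by this file and no item is closed by it; CONDITIONAL
(R₁⁺ and K₄⁺ are beyond print); the registered stub C⁺‴ is untouched.**

The depth-zero reduction criterion is sign-free (`DepthZero.depth_eq_zero_of_geomReduction_ne`; the exclusion `d_K·Δ ∉ ℚ²` follows from the Heegner
hypothesis and `d_K` odd, `GenusExact.not_isSquare_discr_mul_Δ_of_satisfiesHeegnerHypothesis`), so the LEAD's Δ>0 split `GenusSupplyPos.stubC_posDisc_of_selmerSplit`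
(p762235: C⁺‴ ⟸ K₁⁺ ∧ K₄⁺) reduces K₁⁺ to **R₁⁺** := on the `#Sel₂(E) = 1` cell of the Δ>0 habitat, for every frame (admissible `K`, odd-Manin datum,
`d₁` with `y_K` of infinite order, all-silent twin): some good prime `ℓ ∣ d_K` and some lift `P₀ ↦ P(1)` with `red_ℓ(e_* P₀) ∉ red_ℓ(e_*(E(K)_tors^{Aut(K/ℚ)}))`.

* `K1_pos_of_reductionBit : R₁⁺ → K₁⁺`;
* `genusPrimitiveSupplyAtTwoPosDiscShallow_of_items_of_reductionBit : GrossZagierAllLevels → ModularityExistsNewform → TwoParityDD → RankOneTwoConverse →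
  RankOneTwoConverseOffSemistableAtTwo → R₁⁺ → K₄⁺ → GenusPrimitiveSupplyAtTwoPosDiscShallow` — the Δ>0 supply crux BY NAME.

References: [GrossLMS1991] §5 Prop. 5.3, §4 (4.1), Lemma 4.3; [McCallumLMS1991] §5 Lemma 5.1; [MazurRubin2010] Cor. 3.4 (i).
-/

set_option autoImplicit false
set_option linter.dupNamespace false -- `Summit.<P>.<Sub>` repeats `BirchSwinnertonDyer` (D-0017)

noncomputable section

open scoped Classical NumberField Pointwise

namespace Summit.BirchSwinnertonDyer.BirchSwinnertonDyer.Theorems.GenusSupplyNarrow.DepthZero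

open IsDedekindDomain Field NumberField WeierstrassCurve Literature.NumberTheory.EllipticCurves
  Literature.NumberTheory.EllipticCurves.ModularForms Literature.NumberTheory.GaloisRepresentations Rat.HeightOneSpectrum
  Summit.BirchSwinnertonDyer.BirchSwinnertonDyer.Theses.GenusKolyvaginAtTwo
  Summit.BirchSwinnertonDyer.BirchSwinnertonDyer.Theorems.GenusSupplyPos

/-- **K₁⁺ ⟸ R₁⁺ (Δ>0): on the `#Sel₂(E) = 1` cell ONE REDUCTION BIT decides the registered stub C⁺‴.**  `depth_eq_zero_of_geomReduction_ne` gives `M₀ = 0`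
(`ρ̄_{E,2}` onto from the habitat at `n = 1`; `d_K·Δ ∉ ℚ²` from the Heegner hypothesis with `d_K` odd), contradicting `1 ≤ M₀`.  CONDITIONAL on R₁⁺.
[cite: GrossLMS1991, §5 Prop. 5.3, §4 (4.1), Lemma 4.3] [cite: McCallumLMS1991, §5 Lemma 5.1] -/
theorem K1_pos_of_reductionBit
    (hR : ∀ (W : WeierstrassCurve ℚ) [W.IsElliptic] [W.IsGloballyMinimal] [NeZero (W.conductorNorm ℤ)],
      ¬ W.HasCM → W.analyticRank = 0 → (∀ n : ℕ, 0 < n → W.HasSurjectiveModNGaloisRep ((2 : ℤ) ^ n)) →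
      Odd W.tamagawaProduct → 0 < W.Δ →
      Nat.card (W.selmerGroup 2) = 1 →
      ∀ (K : Type) [Field K] [NumberField K],
      IsImaginaryQuadratic K → Odd (NumberField.discr K) → NumberField.discr K ≠ -3 →
      SatisfiesHeegnerHypothesis (W.conductorNorm ℤ) K →
      ¬ IsSquare ((NumberField.discr K : ℚ) * -|W.Δ|) → ¬ IsSquare ((NumberField.discr K : ℚ) * (-(2 * |W.Δ|))) →
      ∀ (Dt : ModularParametrizationData W (W.conductorNorm ℤ)),
      (∀ z ∈ Dt.L.lattice, ∃ w ∈ periodLattice Dt.f, z = (Dt.c : ℂ) * w) → Odd Dt.c →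
      ∀ (β : ℤ) (ι : K →+* ℂ) (d₁ : KolyvaginHeegnerData Dt β ι 1), ¬ IsOfFinAddOrder d₁.derivedPoint →
      ∀ (Wd : WeierstrassCurve ℚ) [Wd.IsElliptic] [Wd.IsGloballyMinimal],
      (∃ C : WeierstrassCurve.VariableChange ℚ, C • W.quadraticTwist (NumberField.discr K : ℚ) = Wd) →
      Wd.analyticRank = 1 → Nat.card (Wd.selmerGroup 2) = 2 → padicValNat 2 Wd.tamagawaProduct = 0 →
      ∃ (ℓ : ℕ) (_ : Fact ℓ.Prime) (_ : (ℓ : ℤ) ∣ NumberField.discr K) (hΔ : ¬ (ℓ : ℤ) ∣ minimalDiscriminantInt W)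
        (P₀ : (W.baseChange K).toAffine.Point),
        Affine.Point.map (W' := W) (algebraMap K (ringClassField K ι 1)).toRatAlgHom P₀ = d₁.derivedPoint ∧
        ∀ s : (W.baseChange K).toAffine.Point, IsOfFinAddOrder s → (∀ σ : K ≃ₐ[ℚ] K, σ • s = s) →
          geomReduction hΔ (Affine.Point.map (W' := W) (absEmbedding ℚ K) P₀ : W.geomPoints) ≠
            geomReduction hΔ (Affine.Point.map (W' := W) (absEmbedding ℚ K) s : W.geomPoints)) :
    ∀ (W : WeierstrassCurve ℚ) [W.IsElliptic] [W.IsGloballyMinimal] [NeZero (W.conductorNorm ℤ)],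
      ¬ W.HasCM → W.analyticRank = 0 → (∀ n : ℕ, 0 < n → W.HasSurjectiveModNGaloisRep ((2 : ℤ) ^ n)) →
      Odd W.tamagawaProduct → 0 < W.Δ →
      Nat.card (W.selmerGroup 2) = 1 →
      ∀ (K : Type) [Field K] [NumberField K],
      IsImaginaryQuadratic K → Odd (NumberField.discr K) → NumberField.discr K ≠ -3 →
      SatisfiesHeegnerHypothesis (W.conductorNorm ℤ) K →
      ¬ IsSquare ((NumberField.discr K : ℚ) * -|W.Δ|) → ¬ IsSquare ((NumberField.discr K : ℚ) * (-(2 * |W.Δ|))) →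
      ∀ (Dt : ModularParametrizationData W (W.conductorNorm ℤ)),
      (∀ z ∈ Dt.L.lattice, ∃ w ∈ periodLattice Dt.f, z = (Dt.c : ℂ) * w) → Odd Dt.c →
      ∀ (β : ℤ) (ι : K →+* ℂ) (d₁ : KolyvaginHeegnerData Dt β ι 1), ¬ IsOfFinAddOrder d₁.derivedPoint →
      ∀ (M₀ : ℕ), (∃ Q : (W.baseChange (ringClassField K ι 1)).toAffine.Point, ((2 ^ M₀ : ℕ) : ℤ) • Q = d₁.derivedPoint) →
      (¬ ∃ Q : (W.baseChange (ringClassField K ι 1)).toAffine.Point, ((2 ^ (M₀ + 1) : ℕ) : ℤ) • Q = d₁.derivedPoint) →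
      1 ≤ M₀ →
      ∀ (Wd : WeierstrassCurve ℚ) [Wd.IsElliptic] [Wd.IsGloballyMinimal],
      (∃ C : WeierstrassCurve.VariableChange ℚ, C • W.quadraticTwist (NumberField.discr K : ℚ) = Wd) →
      Wd.analyticRank = 1 → Nat.card (Wd.selmerGroup 2) = 2 → padicValNat 2 Wd.tamagawaProduct = 0 →
      False := by
  intro W _ _ _ hcm hr0 hρ hT hpos h1 K _ _ hIQ hodd h3 hHe hsq1 hsq2 Dt hoptDt hc β ι d₁ hy M₀ hdiv _hndiv hM Wd _ _ hWd hrd hSel hDEF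
  obtain ⟨ℓ, hℓp, hℓ, hΔ, P₀, hP₀, hred⟩ :=
    hR W hcm hr0 hρ hT hpos h1 K hIQ hodd h3 hHe hsq1 hsq2 Dt hoptDt hc β ι d₁ hy Wd hWd hrd hSel hDEF
  have hρ2 : W.HasSurjectiveModNGaloisRep 2 := by simpa using hρ 1 one_pos
  have hD4 : NumberField.discr K ≠ -4 := by
    rintro h4; rw [h4] at hodd; exact absurd hodd (by decide)
  have hsq : ¬ IsSquare ((NumberField.discr K : ℚ) * W.Δ) :=
    GenusExact.not_isSquare_discr_mul_Δ_of_satisfiesHeegnerHypothesis W hIQ hHe hD4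
  have hM0 : M₀ = 0 := depth_eq_zero_of_geomReduction_ne W hIQ hHe hr0 hρ2 hsq hℓ hΔ Dt β ι d₁ hP₀ hred hdiv
  omega

/-- **THE Δ>0 SUPPLY CRUX FROM FIVE ROUTE ITEMS + THE REDUCTION BIT R₁⁺ + K₄⁺** (`genusPrimitiveSupplyAtTwoPosDiscShallow_of_items_of_selmerSplit` ∘
`K1_pos_of_reductionBit`).  CONDITIONAL on R₁⁺, K₄⁺ and the two declared rank-one `2`-converse items; BSD is NOT proved by this.
[cite: GrossZagier1986, Thm. I.6.3 with V.§2] [cite: MazurRubin2010, Cor. 3.4 (i)] [cite: GrossLMS1991, §3 (3.5), §4 (4.1), §5 Prop. 5.3] -/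
theorem genusPrimitiveSupplyAtTwoPosDiscShallow_of_items_of_reductionBit (hGZ : GrossZagierAllLevels) (hmod : ModularityExistsNewform)
    (hpar : TwoParityDD) (hconv : RankOneTwoConverse) (hconv' : RankOneTwoConverseOffSemistableAtTwo)
    (hR : ∀ (W : WeierstrassCurve ℚ) [W.IsElliptic] [W.IsGloballyMinimal] [NeZero (W.conductorNorm ℤ)],
      ¬ W.HasCM → W.analyticRank = 0 → (∀ n : ℕ, 0 < n → W.HasSurjectiveModNGaloisRep ((2 : ℤ) ^ n)) →
      Odd W.tamagawaProduct → 0 < W.Δ →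
      Nat.card (W.selmerGroup 2) = 1 →
      ∀ (K : Type) [Field K] [NumberField K],
      IsImaginaryQuadratic K → Odd (NumberField.discr K) → NumberField.discr K ≠ -3 →
      SatisfiesHeegnerHypothesis (W.conductorNorm ℤ) K →
      ¬ IsSquare ((NumberField.discr K : ℚ) * -|W.Δ|) → ¬ IsSquare ((NumberField.discr K : ℚ) * (-(2 * |W.Δ|))) →
      ∀ (Dt : ModularParametrizationData W (W.conductorNorm ℤ)),
      (∀ z ∈ Dt.L.lattice, ∃ w ∈ periodLattice Dt.f, z = (Dt.c : ℂ) * w) → Odd Dt.c →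
      ∀ (β : ℤ) (ι : K →+* ℂ) (d₁ : KolyvaginHeegnerData Dt β ι 1), ¬ IsOfFinAddOrder d₁.derivedPoint →
      ∀ (Wd : WeierstrassCurve ℚ) [Wd.IsElliptic] [Wd.IsGloballyMinimal],
      (∃ C : WeierstrassCurve.VariableChange ℚ, C • W.quadraticTwist (NumberField.discr K : ℚ) = Wd) →
      Wd.analyticRank = 1 → Nat.card (Wd.selmerGroup 2) = 2 → padicValNat 2 Wd.tamagawaProduct = 0 →
      ∃ (ℓ : ℕ) (_ : Fact ℓ.Prime) (_ : (ℓ : ℤ) ∣ NumberField.discr K) (hΔ : ¬ (ℓ : ℤ) ∣ minimalDiscriminantInt W)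
        (P₀ : (W.baseChange K).toAffine.Point),
        Affine.Point.map (W' := W) (algebraMap K (ringClassField K ι 1)).toRatAlgHom P₀ = d₁.derivedPoint ∧
        ∀ s : (W.baseChange K).toAffine.Point, IsOfFinAddOrder s → (∀ σ : K ≃ₐ[ℚ] K, σ • s = s) →
          geomReduction hΔ (Affine.Point.map (W' := W) (absEmbedding ℚ K) P₀ : W.geomPoints) ≠
            geomReduction hΔ (Affine.Point.map (W' := W) (absEmbedding ℚ K) s : W.geomPoints))
    (hK4 : ∀ (W : WeierstrassCurve ℚ) [W.IsElliptic] [W.IsGloballyMinimal] [NeZero (W.conductorNorm ℤ)],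
      ¬ W.HasCM → W.analyticRank = 0 → (∀ n : ℕ, 0 < n → W.HasSurjectiveModNGaloisRep ((2 : ℤ) ^ n)) →
      Odd W.tamagawaProduct → 0 < W.Δ →
      (Nat.card (W.selmerGroup 2) = 4 ∧ ∃ c ∈ (W.kummerSelmerStructure ((2 : ℕ) : ℤ)).selmerGroup, Literature.NumberTheory.GaloisRepresentations.galoisCohomology.localization (W.torsionGaloisModule ((2 : ℕ) : ℤ)) (Sum.inl Rat.infinitePlace) 1 c ≠ 0) →
      ∀ (K : Type) [Field K] [NumberField K],
      IsImaginaryQuadratic K → Odd (NumberField.discr K) → NumberField.discr K ≠ -3 →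
      SatisfiesHeegnerHypothesis (W.conductorNorm ℤ) K →
      ¬ IsSquare ((NumberField.discr K : ℚ) * -|W.Δ|) → ¬ IsSquare ((NumberField.discr K : ℚ) * (-(2 * |W.Δ|))) →
      ∀ (Dt : ModularParametrizationData W (W.conductorNorm ℤ)),
      (∀ z ∈ Dt.L.lattice, ∃ w ∈ periodLattice Dt.f, z = (Dt.c : ℂ) * w) → Odd Dt.c →
      ∀ (β : ℤ) (ι : K →+* ℂ) (d₁ : KolyvaginHeegnerData Dt β ι 1), ¬ IsOfFinAddOrder d₁.derivedPoint →
      ∀ (M₀ : ℕ), (∃ Q : (W.baseChange (ringClassField K ι 1)).toAffine.Point, ((2 ^ M₀ : ℕ) : ℤ) • Q = d₁.derivedPoint) →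
      (¬ ∃ Q : (W.baseChange (ringClassField K ι 1)).toAffine.Point, ((2 ^ (M₀ + 1) : ℕ) : ℤ) • Q = d₁.derivedPoint) →
      1 ≤ M₀ →
      ∀ (Wd : WeierstrassCurve ℚ) [Wd.IsElliptic] [Wd.IsGloballyMinimal],
      (∃ C : WeierstrassCurve.VariableChange ℚ, C • W.quadraticTwist (NumberField.discr K : ℚ) = Wd) →
      Wd.analyticRank = 1 → Nat.card (Wd.selmerGroup 2) = 2 → padicValNat 2 Wd.tamagawaProduct = 0 →
      ∃ (n : ℕ) (d : KolyvaginHeegnerData Dt β ι n), Squarefree n ∧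
        (∀ ℓ ∈ n.primeFactors, Zhang2014.IsKolyvaginPrime (W.conductorNorm ℤ) W K 2 ℓ ∧ 2 ≤ Zhang2014.kolyvaginIndex W 2 ℓ ∧
          ∃ (v : IsDedekindDomain.HeightOneSpectrum (NumberField.RingOfIntegers ℚ)) (𝔓 : Ideal (Literature.NumberTheory.GaloisRepresentations.absIntegers (NumberField.RingOfIntegers ℚ) ℚ)) (h : Field.absoluteGaloisGroup ℚ), ((ℓ : ℕ) : NumberField.RingOfIntegers ℚ) ∈ v.asIdeal ∧ 𝔓 ∈ v.primesAbove ∧ IsArithFrobAt (NumberField.RingOfIntegers ℚ) h 𝔓 ∧ ∃ u : W.geomTorsion ((2 : ℕ) : ℤ), h • u ≠ u) ∧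
        ¬ ∃ Q : (W.baseChange (ringClassField K ι n)).toAffine.Point, (2 : ℤ) • Q = d.derivedPoint) :
    GenusPrimitiveSupplyAtTwoPosDiscShallow :=
  genusPrimitiveSupplyAtTwoPosDiscShallow_of_items_of_selmerSplit hGZ hmod hpar hconv hconv' (K1_pos_of_reductionBit hR) hK4

end Summit.BirchSwinnertonDyer.BirchSwinnertonDyer.Theorems.GenusSupplyNarrow.DepthZero

end
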